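import Summits.BirchSwinnertonDyer.BirchSwinnertonDyer.Theses.ShadowIsolation
import Literature.NumberTheory.EllipticCurves.LFunctionSmulProofs
import Literature.NumberTheory.EllipticCurves.LFunctionPrimeCoeff
import Literature.NumberTheory.EllipticCurves.GlobalMinimalModelProofs

/-!
# BirchSwinnertonDyer / ShadowIsolation — crux `ShaCotorsionReducible` (stmt-BirchSwinnertonDyer-15277),
# line `eisenstein-shadow` v3, stub DC_red (`stub_deepCongruenceFiniteReducible`): first glue lemmas

Two small PROVED reductions that any formalisation of the reducible-sector deep-congruence finiteness
DC_red (skeleton `Cruxes/ShaCotorsionReducible/Lines/eisenstein_shadow.lean`, stub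
`stub_deepCongruenceFiniteReducible`; proof on paper in the item evidence `FRed-analysis.md` v2) needs
first (stub-worker of lead c4, wave 2):
* `deepCongruenceSet_eq_globallyMinimal` — the coefficient set of DC_red is unchanged when the curves
  `W'` are restricted to GLOBALLY MINIMAL models (`hasGlobalMinimalModel_rat_holds`, `LFunction_smul`:
  Mathlib's `WeierstrassCurve.LFunction` is computed on local minimal models, so it is model-independent);
* `exists_finset_frobeniusTrace_congr` — a cofinite congruence of prime-indexed `L`-coefficients is a
  cofinite congruence of traces of Frobenius at the primes of good reduction
  (`LFunction_apply_prime_eq_frobeniusTrace`), the form in which Chebotarev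
  (`chebotarev_geomTorsion_holds`) and the mod-`pⁿ` representations `galoisRepTorsion` take over.
Inventory of what the tree has / lacks for the rest (mod-`pⁿ` traces: short glue from
`trace_galoisRepTate_frobenius_eq_frobeniusTrace`; Chebotarev: proved; Faltings for genus `≥ 2` and the
modular curves `X₁(p²)`, `X(p²)/Γ̄` with moduli interpretation on `WeierstrassCurve ℚ`: ABSENT) is in the
lead's NOTES.md / the worker reply on the item.
-/

set_option linter.dupNamespace false

namespace Summit.BirchSwinnertonDyer.BirchSwinnertonDyer.Theorems

open WeierstrassCurve

/-- The deep-congruence coefficient set of DC_red is unchanged when the curves `W'` are restricted to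
globally minimal Weierstrass models: every elliptic `W'/ℚ` has a global minimal model `C • W'`
(`hasGlobalMinimalModel_rat_holds`) with the same `L`-function (`LFunction_smul`). -/
theorem deepCongruenceSet_eq_globallyMinimal (W : WeierstrassCurve ℚ) (p n : ℕ) :
    {a : ℕ → ℤ | ∃ (W' : WeierstrassCurve ℚ) (_ : W'.IsElliptic), (∀ m : ℕ, a m = W'.LFunction m) ∧
      {ℓ : ℕ | ℓ.Prime ∧ ¬ ((p : ℤ) ^ n ∣ W'.LFunction ℓ - W.LFunction ℓ)}.Finite} =
    {a : ℕ → ℤ | ∃ (W' : WeierstrassCurve ℚ) (_ : W'.IsElliptic) (_ : W'.IsGloballyMinimal),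
      (∀ m : ℕ, a m = W'.LFunction m) ∧
      {ℓ : ℕ | ℓ.Prime ∧ ¬ ((p : ℤ) ^ n ∣ W'.LFunction ℓ - W.LFunction ℓ)}.Finite} := by
  ext a
  constructor
  · rintro ⟨W', hW', ha, hfin⟩
    obtain ⟨C, hC⟩ := hasGlobalMinimalModel_rat_holds W'
    refine ⟨C • W', inferInstance, hC, ?_, ?_⟩
    · simpa only [LFunction_smul] using ha
    · simpa only [LFunction_smul] using hfin
  · rintro ⟨W', hW', -, ha, hfin⟩
    exact ⟨W', hW', ha, hfin⟩

/-- From `L`-coefficients to traces of Frobenius: if `W, W'` are globally minimal elliptic curves over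
`ℚ` whose prime-indexed `L`-coefficients are congruent mod `pⁿ` off a finite set, then off a finite
set of primes, at every prime of good reduction for both, `a_ℓ(W') ≡ a_ℓ(W) (mod pⁿ)`
(`LFunction_apply_prime_eq_frobeniusTrace`). -/
theorem exists_finset_frobeniusTrace_congr : ∀ (W W' : WeierstrassCurve ℚ) [W.IsElliptic] [W.IsGloballyMinimal] [W'.IsElliptic] [W'.IsGloballyMinimal] (p n : ℕ), {ℓ : ℕ | ℓ.Prime ∧ ¬ ((p : ℤ) ^ n ∣ W'.LFunction ℓ - W.LFunction ℓ)}.Finite → ∃ S : Finset ℕ, ∀ (ℓ : ℕ) [Fact ℓ.Prime], ℓ ∉ S → W.HasGoodReductionAtPrime ℓ → W'.HasGoodReductionAtPrime ℓ → (p : ℤ) ^ n ∣ W'.frobeniusTrace ℓ - W.frobeniusTrace ℓ := by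
  intro W W' _ _ _ _ p n hfin
  refine ⟨hfin.toFinset, fun ℓ _ hℓ hW hW' ↦ ?_⟩
  by_contra hdiv
  refine hℓ (hfin.mem_toFinset.mpr ⟨Fact.out, ?_⟩)
  rwa [LFunction_apply_prime_eq_frobeniusTrace W ℓ hW, LFunction_apply_prime_eq_frobeniusTrace W' ℓ hW']

end Summit.BirchSwinnertonDyer.BirchSwinnertonDyer.Theorems
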